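import Mathlib.Algebra.MvPolynomial.PDeriv
import Mathlib.Algebra.MvPolynomial.CommRing
import Mathlib.Algebra.BigOperators.Field
import Mathlib.Algebra.BigOperators.Fin
import Mathlib.RingTheory.Localization.FractionRing
import Mathlib.RingTheory.Localization.Integer
import Literature.NumberTheory.Transcendental.AxDerivationTools
import HarnessLib

/-!
# Exact rational top forms: `f dx₁∧…∧dxₙ = d(…)` over the rational function field `k(x₁,…,xₙ)`

Topic `Literature/NumberTheory/Transcendental` (definition request `defn-IsExactRationalTopForm`
of route `GenericPointClass`, summit KontsevichZagierPeriods).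

Let `k` be a field, `R = k[xᵢ : i ∈ σ] = MvPolynomial σ k` and `K = Frac R = k(xᵢ : i ∈ σ)`
(`FractionRing (MvPolynomial σ k)`).

* `pderivFrac i : Derivation k K K` — the partial derivative `∂ᵢ = ∂/∂xᵢ` on `K`: the **unique**
  `k`-derivation of `K` extending `MvPolynomial.pderiv i` (`pderivFrac_algebraMap`,
  `eq_pderivFrac_of_forall_algebraMap`), i.e. the quotient rule
  `∂ᵢ(p/q) = (∂ᵢp·q − p·∂ᵢq)/q²` (`pderivFrac_div`). Existence and uniqueness of the extension of
  a derivation to the field of fractions are the tree's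
  `exists_derivation_extend_of_isFractionRing` / `derivation_eq_of_isFractionRing`
  (`AxDerivationTools.lean`; Lang, *Algebra*, Ch. VIII §5).
* `IsExactRationalTopForm n f` — for `f ∈ K = k(x₁,…,xₙ)` (`σ = Fin n`): there are
  `A₁,…,Aₙ ∈ K` with `f = Σᵢ ∂ᵢ Aᵢ`. Since `Ω¹_{K/k}` is the `K`-space on `dx₁,…,dxₙ` with
  `dg = Σᵢ ∂ᵢg dxᵢ`, the `(n−1)`-forms are the `η = Σᵢ (−1)^{i−1} Aᵢ dx₁∧…∧\widehat{dxᵢ}∧…∧dxₙ` and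
  `dη = (Σᵢ ∂ᵢAᵢ) dx₁∧…∧dxₙ`; so the predicate says exactly that the top form `f dx₁∧…∧dxₙ` is
  **exact** in the algebraic de Rham complex `Ω•_{K/k}`, i.e. that its class in
  `Hⁿ_dR(K/k) = K / Σᵢ ∂ᵢ(K)` vanishes (the "divergence" shape `F = Σᵢ ∂ᵢAᵢ` with rational `Aᵢ`
  is the one used by the Griffiths–Dwork / creative-telescoping literature, Bostan–Lairez–Salvy
  2013 §2.2–§3, whose Thm. 1 (Griffiths) decides it on smooth hypersurface complements).
* API: the exact forms are a `k`-subspace containing every single derivative `∂ᵢg`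
  (`IsExactRationalTopForm.zero/add/neg/sub/smul`, `isExactRationalTopForm_pderivFrac`); in `0`
  variables only `0` is exact; in `≥ 1` variables `1 = ∂₀x₀` is exact; and — the bridge to the
  polynomial certificates `(A, B, D)` used by the route's items `OneStepDescentExact`,
  `OneStepDescentExactDimOne`, `HyperbolaFormNotExact` — **clearing denominators**:
  `IsExactRationalTopForm n (p/q) ↔ ∃ (aᵢ) D ≠ 0, p·D² = q·Σᵢ (∂ᵢaᵢ·D − aᵢ·∂ᵢD)`
  (`isExactRationalTopForm_div_iff`, and its `n = 1`, `n = 2` spellings), so that e.g.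
  `HyperbolaFormNotExact` reads `¬ IsExactRationalTopForm 2 (1/(1 − x₀x₁))`
  (`isExactRationalTopForm_two_inv_iff`).

Design: `k` is any field (implicit; the requester's case is `k = ℚ`), `σ` any index type for
`pderivFrac`; the predicate keeps the requested signature `(n : ℕ) (f : Frac ℚ[x₁..xₙ])` with
`σ = Fin n`. `pderivFrac` is *defined* as the (chosen) extension and pinned down by the uniqueness
lemma, so every computation goes through `pderivFrac_algebraMap` / `pderivFrac_div`.

Not here: a Kähler-differential model of `Ωⁿ_{K/k}` (the identification above is the docstring's
justification, not a theorem of this file); the Griffiths–Dwork decision procedure; residues /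
the non-exactness of `dx/x` or of `dx∧dy/(1−xy)` (these are the route's theorems).

## References

* R. Hartshorne, *On the de Rham cohomology of algebraic varieties*, Publ. Math. IHÉS 45 (1975),
  5–99 (algebraic de Rham cohomology). [Hartshorne1975]
* A. Bostan, P. Lairez, B. Salvy, *Creative telescoping for rational functions using the
  Griffiths–Dwork method*, ISSAC 2013, 93–100, §2.2–§3 (arXiv:1301.4313). [BostanLairezSalvy2013]
* S. Lang, *Algebra*, 3rd ed., GTM 211 (2002), Ch. VIII §5 (derivations of fraction fields).
  [Lang2002]
-/

noncomputable section

open MvPolynomial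

namespace Literature.NumberTheory.Transcendental

/-! ### The partial derivatives `∂/∂xᵢ` of the rational function field -/

section PDerivFrac

variable {k : Type*} [Field k] {σ : Type*}

/-- **`∂/∂xᵢ` on `k(xᵢ : i ∈ σ)`.** The partial derivative with respect to the variable `i` on the
field of fractions `K = Frac k[xᵢ : i ∈ σ]`: the unique `k`-derivation of `K` extending
`MvPolynomial.pderiv i` along `k[x] → K` (see `pderivFrac_algebraMap` and
`eq_pderivFrac_of_forall_algebraMap`; concretely `∂ᵢ(p/q) = (∂ᵢp·q − p·∂ᵢq)/q²`, `pderivFrac_div`).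
[folklore] -/
def pderivFrac (i : σ) :
    Derivation k (FractionRing (MvPolynomial σ k)) (FractionRing (MvPolynomial σ k)) :=
  (exists_derivation_extend_of_isFractionRing (R := k) (A := MvPolynomial σ k)
    (K := FractionRing (MvPolynomial σ k))
    ((Algebra.linearMap (MvPolynomial σ k) (FractionRing (MvPolynomial σ k))).compDer
      (MvPolynomial.pderiv i))).choose

/-- `∂ᵢ` extends `MvPolynomial.pderiv i`: `∂ᵢ (p/1) = (pderiv i p)/1`. [folklore] -/
@[simp]
theorem pderivFrac_algebraMap (i : σ) (p : MvPolynomial σ k) :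
    pderivFrac i (algebraMap (MvPolynomial σ k) (FractionRing (MvPolynomial σ k)) p) =
      algebraMap (MvPolynomial σ k) (FractionRing (MvPolynomial σ k)) (pderiv i p) :=
  (exists_derivation_extend_of_isFractionRing (R := k) (A := MvPolynomial σ k)
    (K := FractionRing (MvPolynomial σ k))
    ((Algebra.linearMap (MvPolynomial σ k) (FractionRing (MvPolynomial σ k))).compDer
      (MvPolynomial.pderiv i))).choose_spec p

/-- **Uniqueness.** A `k`-derivation of `k(x)` which agrees with `pderiv i` on polynomials is
`∂ᵢ` (two derivations of a field of fractions agreeing on the ring agree). [folklore] -/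
theorem eq_pderivFrac_of_forall_algebraMap {i : σ}
    (D : Derivation k (FractionRing (MvPolynomial σ k)) (FractionRing (MvPolynomial σ k)))
    (hD : ∀ p : MvPolynomial σ k,
      D (algebraMap (MvPolynomial σ k) (FractionRing (MvPolynomial σ k)) p) =
        algebraMap (MvPolynomial σ k) (FractionRing (MvPolynomial σ k)) (pderiv i p)) :
    D = pderivFrac i :=
  derivation_eq_of_isFractionRing (A := MvPolynomial σ k) D (pderivFrac i) fun p => by
    rw [hD, pderivFrac_algebraMap]

/-- `∂ᵢ xᵢ = 1`. [folklore] -/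
theorem pderivFrac_X_self (i : σ) :
    pderivFrac i (algebraMap (MvPolynomial σ k) (FractionRing (MvPolynomial σ k)) (X i)) = 1 := by
  rw [pderivFrac_algebraMap, pderiv_X_self, map_one]

/-- `∂ᵢ xⱼ = 0` for `j ≠ i`. [folklore] -/
theorem pderivFrac_X_of_ne {i j : σ} (h : j ≠ i) :
    pderivFrac i (algebraMap (MvPolynomial σ k) (FractionRing (MvPolynomial σ k)) (X j)) = 0 := by
  rw [pderivFrac_algebraMap, pderiv_X_of_ne h, map_zero]

/-- `∂ᵢ c = 0` for constants `c ∈ k`. [folklore] -/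
theorem pderivFrac_algebraMap_base (i : σ) (c : k) :
    pderivFrac i (algebraMap k (FractionRing (MvPolynomial σ k)) c) = 0 :=
  (pderivFrac i).map_algebraMap c

/-- **Quotient rule**: `∂ᵢ(p/q) = (∂ᵢp·q − p·∂ᵢq)/q²` for polynomials `p, q` (both sides are `0`
when `q = 0`). [folklore] -/
theorem pderivFrac_div (i : σ) (p q : MvPolynomial σ k) :
    pderivFrac i (algebraMap (MvPolynomial σ k) (FractionRing (MvPolynomial σ k)) p /
        algebraMap (MvPolynomial σ k) (FractionRing (MvPolynomial σ k)) q) =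
      (algebraMap _ (FractionRing (MvPolynomial σ k)) (pderiv i p) *
            algebraMap _ (FractionRing (MvPolynomial σ k)) q -
          algebraMap _ (FractionRing (MvPolynomial σ k)) p *
            algebraMap _ (FractionRing (MvPolynomial σ k)) (pderiv i q)) /
        algebraMap _ (FractionRing (MvPolynomial σ k)) q ^ 2 := by
  rw [Derivation.leibniz_div, pderivFrac_algebraMap, pderivFrac_algebraMap]
  simp only [smul_eq_mul]
  rw [div_eq_mul_inv, ← inv_pow]
  ring

end PDerivFrac

/-! ### Exactness of a rational top form -/

section Exact

variable {k : Type*} [Field k]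

/-- **Exact rational top forms.** For `f ∈ K = k(x₁,…,xₙ) = Frac k[x₁,…,xₙ]`
(`FractionRing (MvPolynomial (Fin n) k)`; the requester's case is `k = ℚ`):
`IsExactRationalTopForm n f` means that there are rational functions `A₁,…,Aₙ ∈ K` with
`f = Σᵢ ∂ᵢ Aᵢ` (`∂ᵢ = pderivFrac i`), i.e. that the top-degree form `f dx₁∧…∧dxₙ` is exact in the
algebraic de Rham complex of `K/k`: `f dx₁∧…∧dxₙ = d(Σᵢ (−1)^{i−1} Aᵢ dx₁∧…\widehat{dxᵢ}…∧dxₙ)`,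
equivalently its class in `Hⁿ_dR(K/k) = K / Σᵢ ∂ᵢK` is zero. For `n = 0` (`K = k`) only `f = 0`
is exact. [folklore] -/
def IsExactRationalTopForm (n : ℕ) (f : FractionRing (MvPolynomial (Fin n) k)) : Prop :=
  ∃ A : Fin n → FractionRing (MvPolynomial (Fin n) k), f = ∑ i, pderivFrac i (A i)

/-- Unfolding lemma. [folklore] -/
theorem isExactRationalTopForm_iff {n : ℕ} (f : FractionRing (MvPolynomial (Fin n) k)) :
    IsExactRationalTopForm n f ↔
      ∃ A : Fin n → FractionRing (MvPolynomial (Fin n) k), f = ∑ i, pderivFrac i (A i) :=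
  Iff.rfl

/-- A divergence `Σᵢ ∂ᵢAᵢ` is exact (by definition). [folklore] -/
theorem isExactRationalTopForm_sum_pderivFrac {n : ℕ}
    (A : Fin n → FractionRing (MvPolynomial (Fin n) k)) :
    IsExactRationalTopForm n (∑ i, pderivFrac i (A i)) :=
  ⟨A, rfl⟩

/-- A single partial derivative `∂ᵢ g` is exact. [folklore] -/
theorem isExactRationalTopForm_pderivFrac {n : ℕ} (i : Fin n)
    (g : FractionRing (MvPolynomial (Fin n) k)) :
    IsExactRationalTopForm n (pderivFrac i g) := by
  classical
  refine ⟨Pi.single i g, ?_⟩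
  rw [Finset.sum_eq_single i (fun j _ hj => by rw [Pi.single_eq_of_ne hj, map_zero])
    (fun h => (h (Finset.mem_univ i)).elim), Pi.single_eq_same]

/-- `0` is exact. [folklore] -/
theorem IsExactRationalTopForm.zero (n : ℕ) :
    IsExactRationalTopForm n (0 : FractionRing (MvPolynomial (Fin n) k)) :=
  ⟨0, by simp⟩

/-- Exact forms are closed under addition. [folklore] -/
theorem IsExactRationalTopForm.add {n : ℕ} {f g : FractionRing (MvPolynomial (Fin n) k)}
    (hf : IsExactRationalTopForm n f) (hg : IsExactRationalTopForm n g) :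
    IsExactRationalTopForm n (f + g) := by
  obtain ⟨A, rfl⟩ := hf
  obtain ⟨B, rfl⟩ := hg
  exact ⟨A + B, by simp [Finset.sum_add_distrib]⟩

/-- Exact forms are closed under negation. [folklore] -/
theorem IsExactRationalTopForm.neg {n : ℕ} {f : FractionRing (MvPolynomial (Fin n) k)}
    (hf : IsExactRationalTopForm n f) : IsExactRationalTopForm n (-f) := by
  obtain ⟨A, rfl⟩ := hf
  exact ⟨-A, by simp [Finset.sum_neg_distrib]⟩

/-- Exact forms are closed under subtraction. [folklore] -/
theorem IsExactRationalTopForm.sub {n : ℕ} {f g : FractionRing (MvPolynomial (Fin n) k)}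
    (hf : IsExactRationalTopForm n f) (hg : IsExactRationalTopForm n g) :
    IsExactRationalTopForm n (f - g) := by
  rw [sub_eq_add_neg]
  exact hf.add hg.neg

/-- Exact forms are closed under multiplication by constants `c ∈ k`. [folklore] -/
theorem IsExactRationalTopForm.smul {n : ℕ} {f : FractionRing (MvPolynomial (Fin n) k)}
    (c : k) (hf : IsExactRationalTopForm n f) : IsExactRationalTopForm n (c • f) := by
  obtain ⟨A, rfl⟩ := hf
  exact ⟨c • A, by simp [Finset.smul_sum]⟩

/-- In `0` variables (`K = k`, no derivatives) only `0` is exact. [folklore] -/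
theorem isExactRationalTopForm_zero_iff (f : FractionRing (MvPolynomial (Fin 0) k)) :
    IsExactRationalTopForm 0 f ↔ f = 0 := by
  constructor
  · rintro ⟨A, rfl⟩
    simp
  · rintro rfl
    exact IsExactRationalTopForm.zero 0

/-- Non-vacuity: in `n + 1 ≥ 1` variables the constant form `1·dx = d(x₀ dx₁∧…∧dxₙ)` is exact
(`1 = ∂₀ x₀`). [folklore] -/
theorem isExactRationalTopForm_one (n : ℕ) :
    IsExactRationalTopForm (n + 1) (1 : FractionRing (MvPolynomial (Fin (n + 1)) k)) := by
  have h := isExactRationalTopForm_pderivFrac (k := k) (0 : Fin (n + 1))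
    (algebraMap (MvPolynomial (Fin (n + 1)) k) _ (X 0))
  rwa [pderivFrac_X_self] at h

/-! ### Clearing denominators: polynomial certificates -/

/-- **Exactness by a polynomial certificate.** `f ∈ k(x₁,…,xₙ)` is exact iff there are
polynomials `a₁,…,aₙ` and `D ≠ 0` with `f·D² = Σᵢ (∂ᵢaᵢ·D − aᵢ·∂ᵢD)` (take a common denominator
`Aᵢ = aᵢ/D` and use the quotient rule). [folklore] -/
theorem isExactRationalTopForm_iff_exists_mvPolynomial {n : ℕ}
    (f : FractionRing (MvPolynomial (Fin n) k)) :
    IsExactRationalTopForm n f ↔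
      ∃ (a : Fin n → MvPolynomial (Fin n) k) (D : MvPolynomial (Fin n) k), D ≠ 0 ∧
        f * algebraMap (MvPolynomial (Fin n) k) _ D ^ 2 =
          algebraMap (MvPolynomial (Fin n) k) _ (∑ i, (pderiv i (a i) * D - a i * pderiv i D)) := by
  constructor
  · rintro ⟨A, rfl⟩
    obtain ⟨b, hb⟩ := IsLocalization.exist_integer_multiples_of_finite
      (nonZeroDivisors (MvPolynomial (Fin n) k)) A
    choose a ha using fun i => RingHom.mem_rangeS.mp (hb i)
    have hb0 : algebraMap (MvPolynomial (Fin n) k) (FractionRing (MvPolynomial (Fin n) k)) b ≠ 0 :=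
      IsFractionRing.to_map_ne_zero_of_mem_nonZeroDivisors b.2
    have hA : ∀ i, A i = algebraMap _ _ (a i) /
        algebraMap (MvPolynomial (Fin n) k) (FractionRing (MvPolynomial (Fin n) k)) b := fun i => by
      rw [eq_div_iff hb0, ha i, Algebra.smul_def, mul_comm]
    refine ⟨a, b, nonZeroDivisors.coe_ne_zero b, ?_⟩
    simp_rw [hA, pderivFrac_div]
    rw [← Finset.sum_div, div_mul_cancel₀ _ (pow_ne_zero 2 hb0)]
    simp only [map_sum, map_sub, map_mul]
  · rintro ⟨a, D, hD, h⟩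
    have hD0 : algebraMap (MvPolynomial (Fin n) k) (FractionRing (MvPolynomial (Fin n) k)) D ≠ 0 :=
      fun h0 => hD (IsFractionRing.to_map_eq_zero_iff.mp h0)
    refine ⟨fun i => algebraMap _ _ (a i) / algebraMap _ _ D, ?_⟩
    simp_rw [pderivFrac_div]
    rw [← Finset.sum_div, eq_div_iff (pow_ne_zero 2 hD0), h]
    simp only [map_sum, map_sub, map_mul]

/-- **Exactness of `p/q` by a polynomial certificate.** For polynomials `p` and `q ≠ 0`:
`(p/q)·dx₁∧…∧dxₙ` is exact over `k(x)` iff `p·D² = q·Σᵢ (∂ᵢaᵢ·D − aᵢ·∂ᵢD)` for some polynomials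
`aᵢ` and `D ≠ 0` — the certificate shape of the route items `OneStepDescentExact(DimOne)`.
[folklore] -/
theorem isExactRationalTopForm_div_iff {n : ℕ} (p q : MvPolynomial (Fin n) k) (hq : q ≠ 0) :
    IsExactRationalTopForm n
        (algebraMap _ (FractionRing (MvPolynomial (Fin n) k)) p /
          algebraMap _ (FractionRing (MvPolynomial (Fin n) k)) q) ↔
      ∃ (a : Fin n → MvPolynomial (Fin n) k) (D : MvPolynomial (Fin n) k), D ≠ 0 ∧
        p * D ^ 2 = q * ∑ i, (pderiv i (a i) * D - a i * pderiv i D) := by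
  have hq0 : algebraMap (MvPolynomial (Fin n) k) (FractionRing (MvPolynomial (Fin n) k)) q ≠ 0 :=
    fun h0 => hq (IsFractionRing.to_map_eq_zero_iff.mp h0)
  rw [isExactRationalTopForm_iff_exists_mvPolynomial]
  refine exists_congr fun a => exists_congr fun D => and_congr_right fun _ => ?_
  rw [div_mul_eq_mul_div, div_eq_iff hq0, ← map_pow, ← map_mul, ← map_mul,
    (IsFractionRing.injective (MvPolynomial (Fin n) k) (FractionRing (MvPolynomial (Fin n) k))).eq_iff,
    mul_comm q]

/-- `n = 1`: `(p/q) dx` is exact over `k(x)` iff `p·D² = q·(a′D − a·D′)` for some polynomials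
`a`, `D ≠ 0` (i.e. `p/q = (a/D)′` has a rational primitive) — the certificate of
`OneStepDescentExactDimOne`. [folklore] -/
theorem isExactRationalTopForm_one_div_iff (p q : MvPolynomial (Fin 1) k) (hq : q ≠ 0) :
    IsExactRationalTopForm 1
        (algebraMap _ (FractionRing (MvPolynomial (Fin 1) k)) p /
          algebraMap _ (FractionRing (MvPolynomial (Fin 1) k)) q) ↔
      ∃ (a D : MvPolynomial (Fin 1) k), D ≠ 0 ∧
        p * D ^ 2 = q * (pderiv 0 a * D - a * pderiv 0 D) := by
  rw [isExactRationalTopForm_div_iff p q hq]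
  constructor
  · rintro ⟨a, D, hD, h⟩
    exact ⟨a 0, D, hD, by rw [h, Fin.sum_univ_one]⟩
  · rintro ⟨a, D, hD, h⟩
    exact ⟨fun _ => a, D, hD, by rw [h, Fin.sum_univ_one]⟩

/-- `n = 2`: `(p/q) dx∧dy` is exact over `k(x, y)` iff
`p·D² = q·(∂₀A·D − A·∂₀D + ∂₁B·D − B·∂₁D)` for some polynomials `A, B`, `D ≠ 0` — the certificate
of `OneStepDescentExact`. [folklore] -/
theorem isExactRationalTopForm_two_div_iff (p q : MvPolynomial (Fin 2) k) (hq : q ≠ 0) :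
    IsExactRationalTopForm 2
        (algebraMap _ (FractionRing (MvPolynomial (Fin 2) k)) p /
          algebraMap _ (FractionRing (MvPolynomial (Fin 2) k)) q) ↔
      ∃ (A B D : MvPolynomial (Fin 2) k), D ≠ 0 ∧
        p * D ^ 2 = q * (pderiv 0 A * D - A * pderiv 0 D + pderiv 1 B * D - B * pderiv 1 D) := by
  rw [isExactRationalTopForm_div_iff p q hq]
  constructor
  · rintro ⟨a, D, hD, h⟩
    exact ⟨a 0, a 1, D, hD, by rw [h, Fin.sum_univ_two]; ring⟩
  · rintro ⟨A, B, D, hD, h⟩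
    refine ⟨![A, B], D, hD, ?_⟩
    rw [h, Fin.sum_univ_two]
    simp only [Matrix.cons_val_zero, Matrix.cons_val_one]
    ring

/-- `n = 2`, inverse of a polynomial: `dx∧dy/q` is exact over `k(x, y)` iff
`D² = q·(∂₀A·D − A·∂₀D + ∂₁B·D − B·∂₁D)` for some polynomials `A, B`, `D ≠ 0`; with
`q = 1 − x₀x₁` the negation is literally the route item `HyperbolaFormNotExact`, which thus reads
`¬ IsExactRationalTopForm 2 (1 − x₀x₁)⁻¹`. [folklore] -/
theorem isExactRationalTopForm_two_inv_iff (q : MvPolynomial (Fin 2) k) (hq : q ≠ 0) :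
    IsExactRationalTopForm 2 (algebraMap _ (FractionRing (MvPolynomial (Fin 2) k)) q)⁻¹ ↔
      ∃ (A B D : MvPolynomial (Fin 2) k), D ≠ 0 ∧
        D ^ 2 = q * (pderiv 0 A * D - A * pderiv 0 D + pderiv 1 B * D - B * pderiv 1 D) := by
  rw [inv_eq_one_div, ← map_one (algebraMap (MvPolynomial (Fin 2) k) _),
    isExactRationalTopForm_two_div_iff 1 q hq]
  simp only [one_mul]

end Exact

end Literature.NumberTheory.Transcendental
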